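import Literature.NumberTheory.Automorphic.ArchSchwartzSpace                 -- ★ p848256∕p848394: `archHSGL`, `archHSGL_endoEmbArch`, `two_le_archHSWeight_place`
import Literature.NumberTheory.Automorphic.ArchStableConjugacyLocalGlobal    -- ★ `archPiEquivCM`, `coe_archPiEquivCM_apply`
import Literature.NumberTheory.Automorphic.ArchLocalRegularOrbitClosed        -- ★ `locallyCompactSpace_archLocal`, `secondCountableTopology_archLocal`
import Mathlib.MeasureTheory.Constructions.Pi
import Mathlib.MeasureTheory.Measure.Haar.Unique
import Mathlib.Data.Nat.Log
import HarnessLib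

/-!
# «Places multiply»: polynomial volume growth of product sub-level sets `{∏_w f_w ≤ R}` from polynomial growth of the factors
# (the (VOL-T3) plumbing behind the convergence of Schwartz orbital integrals on `H_∞`; Beuzart-Plessis 2020 §1.5, Harish-Chandra 1966 §9)

Topic `NumberTheory/Rogawski1990`; namespace `Literature.NumberTheory.Rogawski1990`.  THEOREMS ONLY (no definition, no instance, no notation, no axiom, no named
fact, no `sorry`).  Cell `pub/hodgecm-mathlib`, F0∕P3c line LH3 (crux H413 = `stmt-HodgeConjecture-24833`), deal #8 (VOL-T3) of LH3-plan (g0) 2026-09-02T03:13:51Z: the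
input `hvol` of ★ `integrable_descConj_of_archSchwartzGL_of_volumeGrowth` (`ArchSchwartzOrbitalIntegralConvergence`, LH3-p04) asks for `μ{P ≤ R} ≤ A R^e (1 + log R)^m`
where the radius `P = archHSGL ∘ ι_∞` is a PRODUCT over the complex places `w` of `L`; the per-place growth is supplied place by place ((VOL-grp-SL2) ★ `SL2HSBallVolume`,
(T2) `ArchPlaneHaarHSBall`, (VOL-ell-id) ★ `ArchEllipticOrbitHSBall`).  This file multiplies the places.

THE LEMMA (§1, abstract).  On a finite product `Π_i X_i` of σ-finite measure spaces let `f_i : X_i → [1, ∞)` with `μ_i{f_i ≤ ρ} ≤ C_i ρ^a` for `ρ ≥ 1` (`a ≥ 0`).  Then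
`(⊗_i μ_i){x ∣ ∏_i f_i(x_i) ≤ R} ≤ A · R^a · (1 + log R)^r` for `R ≥ 1`, `r = #ι`, `A = (∏_i C_i)(2^a ∕ log 2)^r`.  PROOF (dyadic boxes, no Fubini): for `x` in the set put
`k_i = ⌊log₂ ⌊f_i(x_i)⌋⌋ ∈ ℕ`; then `f_i(x_i) < 2^{k_i+1}` and `2^{Σ k_i} ≤ ∏ ⌊f_i⌋ ≤ R`, so `Σ k_i ≤ K := ⌊log₂ ⌊R⌋⌋`; hence the set is covered by the `≤ (K+1)^r` boxes
`Π_i {f_i < 2^{k_i+1}}` with `k_i ≤ K`, `Σ k_i ≤ K`, each of product measure `≤ ∏_i C_i 2^{a(k_i+1)} ≤ (∏ C_i) 2^{ar} R^a` (`Measure.pi_pi`), and `K + 1 ≤ (1 + log R)∕log 2`.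
The log-power `r` (not the sharp `r − 1`) is what the box count gives; the consumer (`hvol`: SOME `R^e (1 + log R)^m`) does not care.

* §1 `pi_measure_setOf_prod_le_of_marginal_growth` — the abstract lemma (any finite index type, any exponent `a ≥ 0`).
* §2 `exists_isHaarMeasure_pi_prod` bookkeeping and **`haar_setOf_prod_place_le_of_marginal_growth`** — the `H_∞ = U(Φ₂)(L⁺ ⊗ ℝ) × U(Φ₁)(L⁺ ⊗ ℝ)` dress: for ANY Haar
  measure `ν_H` on `H_∞` and per-place functions `F_w ≥ 1` on `U(Φ₂)_w` (★ `archLocal`) whose Haar sub-level sets grow like `C ρ^a`, `ν_H{k ∣ ∏_w F_w(k_{2,w}) ≤ R} ≤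
  A R^a (1 + log R)^m` (Haar uniqueness `isMulLeftInvariant_eq_smul`; ★ `archPiEquivCM`; `U(Φ₁)_∞` compact rides free).
* §3 `haar_setOf_archHSGL_endoEmbArch_le` — the group-side Hilbert–Schmidt reading (`F_w = ‖·‖²_HS + 1`, ★ `archHSGL_endoEmbArch`) from the per-place LINEAR growth
  of HS-balls in `U(1,1)` ((T2-out) of LH3-p02, taken as a hypothesis in its A-boxed shape on `↥(unitaryGroupOfForm (starRingEnd ℂ) Φ₂)`).
HONEST LABEL: HC_CM is proved only modulo the 7 printed citations (2 remaining: hLiu418 = `stmt-HodgeConjecture-24832`, h413 = `stmt-HodgeConjecture-24833`) until rung 0 closes;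
this file is measure-theoretic plumbing for the (VOL) organ behind (CONV) and pays no organ by itself.

## References
* [BeuzartPlessis2020Asterisque] R. Beuzart-Plessis, Astérisque 418 (2020), §1.8 p. 39; §1.2 (1.2.2), (1.2.4) p. 21 (polynomial growth of `Ξ`-weighted balls; convergence of Schwartz
  orbital integrals), §1.2 (norms, `σ`).
* [HarishChandra1966] Harish-Chandra, *Discrete series for semisimple Lie groups II*, Acta Math. 116 (1966), §9.
* [Rogawski1990] J. D. Rogawski, Ann. of Math. Stud. 123 (1990), §4.9 Prop. 4.9.1 (a) p. 55, §14.3 p. 234 (`H_∞`, the archimedean transfer).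
-/

set_option autoImplicit false

noncomputable section

open MeasureTheory MeasureTheory.Measure Set Finset NumberField NumberField.InfinitePlace NumberField.mixedEmbedding
open Literature.NumberTheory.Automorphic Literature.NumberTheory.Automorphic.UnitaryGroup
open scoped ENNReal NNReal MatrixGroups Matrix Classical ComplexOrder

namespace Literature.NumberTheory.Rogawski1990

/-! ## §1 The abstract lemma: dyadic boxes -/

section Abstract

variable {ι : Type*} [Fintype ι] {X : ι → Type*} [∀ i, MeasurableSpace (X i)]

/-- Dyadic exponent of a real `t`: `k = ⌊log₂ ⌊t⌋⌋` has `t < 2^(k+1)`. [folklore] [cite: BeuzartPlessis2020Asterisque, §1.2] -/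
theorem lt_two_pow_log_floor_add_one (t : ℝ) : t < (2 : ℝ) ^ (Nat.log 2 ⌊t⌋₊ + 1) := by
  have h1 : (⌊t⌋₊ : ℝ) + 1 ≤ (2 : ℝ) ^ (Nat.log 2 ⌊t⌋₊ + 1) := by
    have h := Nat.lt_pow_succ_log_self (b := 2) one_lt_two ⌊t⌋₊
    exact_mod_cast h
  exact lt_of_lt_of_le (Nat.lt_floor_add_one t) h1

/-- **«PLACES MULTIPLY» — the abstract lemma.**  On a finite product of σ-finite measure spaces, if `f_i ≥ 1` and `μ_i{f_i ≤ ρ} ≤ C_i ρ^a` for all `ρ ≥ 1` (`a ≥ 0`,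
`C_i ≥ 0`), then `(⊗ μ_i){∏_i f_i(x_i) ≤ R} ≤ A R^a (1 + log R)^{#ι}` for all `R ≥ 1`, with `A = (∏ C_i)(2^a)^{#ι}(log 2)^{-#ι}` (dyadic-box cover: `≤ (⌊log₂ R⌋ + 1)^{#ι}`
boxes `Π_i {f_i < 2^{k_i+1}}`, `Σ k_i ≤ log₂ R`, each of measure `≤ (∏ C_i) 2^{a(Σ k_i + #ι)}` by `Measure.pi_pi`). [folklore] [cite: BeuzartPlessis2020Asterisque, §1.8 p. 39; §1.2 (1.2.4) p. 21] -/
theorem pi_measure_setOf_prod_le_of_marginal_growth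
    (μ : ∀ i, Measure (X i)) [∀ i, SigmaFinite (μ i)] {f : ∀ i, X i → ℝ} (hf1 : ∀ i x, 1 ≤ f i x)
    {a : ℝ} (ha : 0 ≤ a) {C : ι → ℝ} (hC : ∀ i, 0 ≤ C i)
    (hμ : ∀ i (ρ : ℝ), 1 ≤ ρ → μ i {x | f i x ≤ ρ} ≤ ENNReal.ofReal (C i * ρ ^ a)) :
    ∀ R : ℝ, 1 ≤ R →
      Measure.pi μ {x | ∏ i, f i (x i) ≤ R} ≤
        ENNReal.ofReal ((∏ i, C i) * ((2 : ℝ) ^ a) ^ Fintype.card ι / Real.log 2 ^ Fintype.card ι * R ^ a * (1 + Real.log R) ^ Fintype.card ι) := by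
  classical
  intro R hR
  set r : ℕ := Fintype.card ι with hr
  set K : ℕ := Nat.log 2 ⌊R⌋₊ with hK
  set P : ℝ := ∏ i, C i with hP
  have hP0 : 0 ≤ P := Finset.prod_nonneg fun i _ => hC i
  have h2a : (1 : ℝ) ≤ (2 : ℝ) ^ a := Real.one_le_rpow one_le_two ha
  -- the dyadic exponents of a point of the set
  set kx : (∀ i, X i) → ι → ℕ := fun x i => Nat.log 2 ⌊f i (x i)⌋₊ with hkx
  -- the index set of boxes
  set T : Finset (ι → ℕ) := (Fintype.piFinset fun _ : ι => Finset.range (K + 1)).filter fun k => ∑ i, k i ≤ K with hT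
  -- the boxes
  set B : (ι → ℕ) → Set (∀ i, X i) := fun k => Set.pi Set.univ fun i => {t : X i | f i t < (2 : ℝ) ^ (k i + 1)} with hB
  -- (1) cover
  have hcover : {x : ∀ i, X i | ∏ i, f i (x i) ≤ R} ⊆ ⋃ k ∈ T, B k := by
    intro x hx
    have hx' : ∏ i, f i (x i) ≤ R := hx
    -- Σ kx ≤ K
    have hsum : ∑ i, kx x i ≤ K := by
      refine Nat.le_log_of_pow_le one_lt_two ?_
      -- 2 ^ Σ k ≤ ∏ ⌊f⌋ ≤ ⌊∏ f⌋ ≤ ⌊R⌋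
      have h1 : (2 : ℕ) ^ ∑ i, kx x i = ∏ i, 2 ^ kx x i := (Finset.prod_pow_eq_pow_sum _ _ _).symm
      have h2 : ∏ i, (2 : ℕ) ^ kx x i ≤ ∏ i, ⌊f i (x i)⌋₊ :=
        Finset.prod_le_prod' fun i _ => Nat.pow_log_le_self 2 (Nat.floor_pos.2 (hf1 i (x i))).ne'
      have h3 : ((∏ i, ⌊f i (x i)⌋₊ : ℕ) : ℝ) ≤ ∏ i, f i (x i) := by
        rw [Nat.cast_prod]
        exact Finset.prod_le_prod (fun i _ => Nat.cast_nonneg _) fun i _ => Nat.floor_le (zero_le_one.trans (hf1 i (x i)))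
      have h4 : ∏ i, ⌊f i (x i)⌋₊ ≤ ⌊R⌋₊ := Nat.le_floor (h3.trans hx')
      rw [h1]
      exact h2.trans h4
    refine Set.mem_iUnion₂.2 ⟨kx x, ?_, ?_⟩
    · rw [hT, Finset.mem_filter, Fintype.mem_piFinset]
      refine ⟨fun i => Finset.mem_range.2 (Nat.lt_succ_of_le ?_), hsum⟩
      exact (Finset.single_le_sum (fun j _ => Nat.zero_le (kx x j)) (Finset.mem_univ i)).trans hsum
    · rw [hB]
      exact fun i _ => lt_two_pow_log_floor_add_one (f i (x i))
  -- (2) each box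
  have hbox : ∀ k ∈ T, Measure.pi μ (B k) ≤ ENNReal.ofReal (P * ((2 : ℝ) ^ a) ^ r * R ^ a) := by
    intro k hk
    rw [hT, Finset.mem_filter] at hk
    have hksum : ∑ i, k i ≤ K := hk.2
    rw [hB, Measure.pi_pi]
    calc ∏ i, μ i {t : X i | f i t < (2 : ℝ) ^ (k i + 1)}
        ≤ ∏ i, ENNReal.ofReal (C i * ((2 : ℝ) ^ (k i + 1)) ^ a) :=
          Finset.prod_le_prod' fun i _ => (measure_mono fun t (ht : f i t < _) => le_of_lt ht).trans
            (hμ i _ (one_le_pow₀ one_le_two))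
      _ = ENNReal.ofReal (∏ i, C i * ((2 : ℝ) ^ (k i + 1)) ^ a) :=
          (ENNReal.ofReal_prod_of_nonneg fun i _ => mul_nonneg (hC i) (Real.rpow_nonneg (pow_nonneg zero_le_two _) a)).symm
      _ ≤ ENNReal.ofReal (P * ((2 : ℝ) ^ a) ^ r * R ^ a) := ENNReal.ofReal_le_ofReal ?_
    -- ∏ C_i (2^(k_i+1))^a = P · (2^a)^(Σ k_i + r) ≤ P (2^a)^r (2^a)^K ≤ P (2^a)^r R^a
    have hpow : ∀ i, ((2 : ℝ) ^ (k i + 1)) ^ a = ((2 : ℝ) ^ a) ^ (k i + 1) := fun i => by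
      rw [← Real.rpow_natCast ((2 : ℝ) ^ a), ← Real.rpow_mul zero_le_two, mul_comm, Real.rpow_mul zero_le_two, Real.rpow_natCast]
    rw [Finset.prod_mul_distrib]
    simp_rw [hpow]
    rw [Finset.prod_pow_eq_pow_sum, Finset.sum_add_distrib, Finset.sum_const, Finset.card_univ, smul_eq_mul, mul_one, pow_add]
    have hK2 : ((2 : ℝ) ^ a) ^ (∑ i, k i) ≤ R ^ a := by
      calc ((2 : ℝ) ^ a) ^ (∑ i, k i) ≤ ((2 : ℝ) ^ a) ^ K := pow_le_pow_right₀ h2a hksum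
        _ = ((2 : ℝ) ^ K) ^ a := by
            rw [← Real.rpow_natCast ((2 : ℝ) ^ a), ← Real.rpow_mul zero_le_two, mul_comm, Real.rpow_mul zero_le_two, Real.rpow_natCast]
        _ ≤ R ^ a := by
            refine Real.rpow_le_rpow (pow_nonneg zero_le_two K) ?_ ha
            have h1 : ((2 : ℕ) ^ K : ℕ) ≤ ⌊R⌋₊ := Nat.pow_log_le_self 2 (Nat.floor_pos.2 hR).ne'
            have h2 : ((2 : ℝ) ^ K) ≤ (⌊R⌋₊ : ℝ) := by exact_mod_cast h1
            exact h2.trans (Nat.floor_le (zero_le_one.trans hR))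
    calc P * (((2 : ℝ) ^ a) ^ (∑ i, k i) * ((2 : ℝ) ^ a) ^ r)
        = P * ((2 : ℝ) ^ a) ^ r * ((2 : ℝ) ^ a) ^ (∑ i, k i) := by ring
      _ ≤ P * ((2 : ℝ) ^ a) ^ r * R ^ a := mul_le_mul_of_nonneg_left hK2 (mul_nonneg hP0 (pow_nonneg (zero_le_one.trans h2a) r))
  -- (3) number of boxes
  have hcard : (T.card : ℝ) ≤ ((1 + Real.log R) / Real.log 2) ^ r := by
    have h1 : T.card ≤ (K + 1) ^ r := by
      calc T.card ≤ (Fintype.piFinset fun _ : ι => Finset.range (K + 1)).card := Finset.card_filter_le _ _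
        _ = (K + 1) ^ r := by rw [Fintype.card_piFinset]; simp [hr]
    have h2 : ((K : ℝ) + 1) ≤ (1 + Real.log R) / Real.log 2 := by
      have hlog2 : 0 < Real.log 2 := Real.log_pos one_lt_two
      have hlog2' : Real.log 2 ≤ 1 := by
        have := Real.log_two_lt_d9; linarith
      rw [le_div_iff₀ hlog2]
      -- K log 2 ≤ log R  (from 2^K ≤ R)
      have h2K : ((2 : ℝ) ^ K) ≤ R := by
        have h1' : ((2 : ℕ) ^ K : ℕ) ≤ ⌊R⌋₊ := Nat.pow_log_le_self 2 (Nat.floor_pos.2 hR).ne'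
        have h2' : ((2 : ℝ) ^ K) ≤ (⌊R⌋₊ : ℝ) := by exact_mod_cast h1'
        exact h2'.trans (Nat.floor_le (zero_le_one.trans hR))
      have h3 : (K : ℝ) * Real.log 2 ≤ Real.log R := by
        rw [← Real.log_pow]
        exact Real.log_le_log (pow_pos two_pos K) h2K
      have h4 : 0 ≤ Real.log R := Real.log_nonneg hR
      nlinarith
    calc (T.card : ℝ) ≤ ((K + 1) ^ r : ℕ) := by exact_mod_cast h1
      _ = ((K : ℝ) + 1) ^ r := by push_cast; ring
      _ ≤ ((1 + Real.log R) / Real.log 2) ^ r := pow_le_pow_left₀ (by positivity) h2 r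
  -- (4) assemble
  calc Measure.pi μ {x | ∏ i, f i (x i) ≤ R}
      ≤ Measure.pi μ (⋃ k ∈ T, B k) := measure_mono hcover
    _ ≤ ∑ k ∈ T, Measure.pi μ (B k) := measure_biUnion_finset_le T B
    _ ≤ ∑ _k ∈ T, ENNReal.ofReal (P * ((2 : ℝ) ^ a) ^ r * R ^ a) := Finset.sum_le_sum hbox
    _ = (T.card : ℝ≥0∞) * ENNReal.ofReal (P * ((2 : ℝ) ^ a) ^ r * R ^ a) := by rw [Finset.sum_const, nsmul_eq_mul]
    _ = ENNReal.ofReal ((T.card : ℝ) * (P * ((2 : ℝ) ^ a) ^ r * R ^ a)) := by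
        rw [ENNReal.ofReal_mul (Nat.cast_nonneg _), ENNReal.ofReal_natCast]
    _ ≤ ENNReal.ofReal (P * ((2 : ℝ) ^ a) ^ r / Real.log 2 ^ r * R ^ a * (1 + Real.log R) ^ r) := by
        refine ENNReal.ofReal_le_ofReal ?_
        have hnn : 0 ≤ P * ((2 : ℝ) ^ a) ^ r * R ^ a :=
          mul_nonneg (mul_nonneg hP0 (pow_nonneg (zero_le_one.trans h2a) r)) (Real.rpow_nonneg (zero_le_one.trans hR) a)
        calc (T.card : ℝ) * (P * ((2 : ℝ) ^ a) ^ r * R ^ a)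
            ≤ ((1 + Real.log R) / Real.log 2) ^ r * (P * ((2 : ℝ) ^ a) ^ r * R ^ a) := mul_le_mul_of_nonneg_right hcard hnn
          _ = P * ((2 : ℝ) ^ a) ^ r / Real.log 2 ^ r * R ^ a * (1 + Real.log R) ^ r := by rw [div_pow]; ring

/-- **«Places multiply», `∃`-form** matching the `hvol` shape of ★ `integrable_descConj_of_archSchwartzGL_of_volumeGrowth` (`∃ A m, ∀ R ≥ 1, μ{…} ≤ A R^a (1 + log R)^m`).
[folklore] [cite: BeuzartPlessis2020Asterisque, §1.8 p. 39; §1.2 (1.2.4) p. 21] -/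
theorem exists_pi_measure_setOf_prod_le_of_marginal_growth
    (μ : ∀ i, Measure (X i)) [∀ i, SigmaFinite (μ i)] {f : ∀ i, X i → ℝ} (hf1 : ∀ i x, 1 ≤ f i x)
    {a : ℝ} (ha : 0 ≤ a)
    (hμ : ∀ i, ∃ C : ℝ, ∀ ρ : ℝ, 1 ≤ ρ → μ i {x | f i x ≤ ρ} ≤ ENNReal.ofReal (C * ρ ^ a)) :
    ∃ (A : ℝ) (m : ℕ), 0 ≤ A ∧ ∀ R : ℝ, 1 ≤ R →
      Measure.pi μ {x | ∏ i, f i (x i) ≤ R} ≤ ENNReal.ofReal (A * R ^ a * (1 + Real.log R) ^ m) := by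
  classical
  choose C hC using hμ
  -- make the constants non-negative
  have hC' : ∀ i (ρ : ℝ), 1 ≤ ρ → μ i {x | f i x ≤ ρ} ≤ ENNReal.ofReal (max (C i) 0 * ρ ^ a) := fun i ρ hρ =>
    (hC i ρ hρ).trans (ENNReal.ofReal_le_ofReal (mul_le_mul_of_nonneg_right (le_max_left _ _) (Real.rpow_nonneg (zero_le_one.trans hρ) a)))
  refine ⟨(∏ i, max (C i) 0) * ((2 : ℝ) ^ a) ^ Fintype.card ι / Real.log 2 ^ Fintype.card ι, Fintype.card ι, ?_, fun R hR => ?_⟩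
  · exact div_nonneg (mul_nonneg (Finset.prod_nonneg fun i _ => le_max_right _ _) (pow_nonneg (Real.rpow_nonneg zero_le_two a) _))
      (pow_nonneg (Real.log_nonneg one_le_two) _)
  · exact pi_measure_setOf_prod_le_of_marginal_growth μ hf1 ha (fun i => le_max_right _ _) hC' R hR

end Abstract

/-! ## §2 The `H_∞` dress: any Haar measure on `H_∞ = U(Φ₂)(L⁺ ⊗ ℝ) × U(Φ₁)(L⁺ ⊗ ℝ)`, per-place functions on `U(Φ₂)_w` -/

section HInfty

variable (L : Type) [Field L] [NumberField L] [IsCMField L]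

omit [IsCMField L] in
/-- `GL_N(L ⊗ ℝ)` is locally compact (closed embedding `g ↦ (g, g⁻¹)` into `M_N × M_Nᵐᵒᵖ`). [folklore] [cite: BorelJacquet1979, §4.1] -/
theorem locallyCompactSpace_mixedSpaceGL (N : ℕ) : LocallyCompactSpace (GL (Fin N) (mixedSpace L)) := by
  haveI : LocallyCompactSpace (Matrix (Fin N) (Fin N) (mixedSpace L)) :=
    inferInstanceAs (LocallyCompactSpace (Fin N → Fin N → mixedSpace L))
  haveI : LocallyCompactSpace (Matrix (Fin N) (Fin N) (mixedSpace L))ᵐᵒᵖ :=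
    MulOpposite.opHomeomorph.symm.isClosedEmbedding.locallyCompactSpace
  exact Units.isClosedEmbedding_embedProduct.locallyCompactSpace

omit [IsCMField L] in
/-- `GL_N(L ⊗ ℝ)` is second countable. [folklore] [cite: BorelJacquet1979, §4.1] -/
theorem secondCountableTopology_mixedSpaceGL (N : ℕ) : SecondCountableTopology (GL (Fin N) (mixedSpace L)) := by
  haveI : SecondCountableTopology (Matrix (Fin N) (Fin N) (mixedSpace L)) :=
    inferInstanceAs (SecondCountableTopology (Fin N → Fin N → mixedSpace L))
  haveI : SecondCountableTopology (Matrix (Fin N) (Fin N) (mixedSpace L))ᵐᵒᵖ :=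
    MulOpposite.opHomeomorph.symm.secondCountableTopology
  exact Units.isEmbedding_embedProduct.secondCountableTopology

/-- **«PLACES MULTIPLY» ON `H_∞` (any Haar measure).**  Let `F_w ≥ 1` be functions on the place carriers `U(Φ₂)_w` (★ `archLocal`) whose Haar sub-level sets grow like
`ν_w{F_w ≤ ρ} ≤ C ρ^a` (`ρ ≥ 1`, every Haar `ν_w`; `a ≥ 0`).  Then for every Haar measure `ν_H` on `H_∞ = U(Φ₂)(L⁺ ⊗ ℝ) × U(Φ₁)(L⁺ ⊗ ℝ)` there are `A, m` with
`ν_H{k ∣ ∏_w F_w(k_{2,w}) ≤ R} ≤ A R^a (1 + log R)^m` for `R ≥ 1` (`k_{2,w} = archPiEquivCM … k.1 w`): transport along ★ `archPiEquivCM × id`, Haar uniqueness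
(`isMulLeftInvariant_eq_smul`), product Haar = Haar, `U(Φ₁)_∞` compact of finite mass, and §1. [folklore] [cite: BeuzartPlessis2020Asterisque, §1.8 p. 39; §1.2 (1.2.4) p. 21]
[cite: BorelJacquet1979, §4.1] -/
theorem haar_setOf_prod_place_le_of_marginal_growth
    [MeasurableSpace (↥(UnitaryGroup.arch (↥(maximalRealSubfield L)) L (IsCMField.complexConj L) 2 (Matrix.of fun i j : Fin 2 => if i.val + j.val + 1 = 2 then (1 : L) else 0)) × ↥(UnitaryGroup.arch (↥(maximalRealSubfield L)) L (IsCMField.complexConj L) 1 (Matrix.of fun i j : Fin 1 => if i.val + j.val + 1 = 1 then (1 : L) else 0)))] [BorelSpace (↥(UnitaryGroup.arch (↥(maximalRealSubfield L)) L (IsCMField.complexConj L) 2 (Matrix.of fun i j : Fin 2 => if i.val + j.val + 1 = 2 then (1 : L) else 0)) × ↥(UnitaryGroup.arch (↥(maximalRealSubfield L)) L (IsCMField.complexConj L) 1 (Matrix.of fun i j : Fin 1 => if i.val + j.val + 1 = 1 then (1 : L) else 0)))]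
    (νH : Measure (↥(UnitaryGroup.arch (↥(maximalRealSubfield L)) L (IsCMField.complexConj L) 2 (Matrix.of fun i j : Fin 2 => if i.val + j.val + 1 = 2 then (1 : L) else 0)) × ↥(UnitaryGroup.arch (↥(maximalRealSubfield L)) L (IsCMField.complexConj L) 1 (Matrix.of fun i j : Fin 1 => if i.val + j.val + 1 = 1 then (1 : L) else 0)))) [νH.IsHaarMeasure]
    [∀ w : {w : InfinitePlace L // w.IsComplex}, MeasurableSpace ↥(archLocal L 2 (Matrix.of fun i j : Fin 2 => if i.val + j.val + 1 = 2 then (1 : L) else 0) w)]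
    [∀ w : {w : InfinitePlace L // w.IsComplex}, BorelSpace ↥(archLocal L 2 (Matrix.of fun i j : Fin 2 => if i.val + j.val + 1 = 2 then (1 : L) else 0) w)]
    (F : ∀ w : {w : InfinitePlace L // w.IsComplex}, ↥(archLocal L 2 (Matrix.of fun i j : Fin 2 => if i.val + j.val + 1 = 2 then (1 : L) else 0) w) → ℝ) (hF1 : ∀ w y, 1 ≤ F w y) {a : ℝ} (ha : 0 ≤ a)
    (hgrowth : ∀ (w : {w : InfinitePlace L // w.IsComplex}) (ν : Measure ↥(archLocal L 2 (Matrix.of fun i j : Fin 2 => if i.val + j.val + 1 = 2 then (1 : L) else 0) w)) [ν.IsHaarMeasure],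
      ∃ C : ℝ, ∀ ρ : ℝ, 1 ≤ ρ → ν {y | F w y ≤ ρ} ≤ ENNReal.ofReal (C * ρ ^ a)) :
    ∃ (A : ℝ) (m : ℕ), ∀ R : ℝ, 1 ≤ R →
      νH {k | ∏ w, F w (archPiEquivCM 2 L (Matrix.of fun i j : Fin 2 => if i.val + j.val + 1 = 2 then (1 : L) else 0) k.1 w) ≤ R} ≤ ENNReal.ofReal (A * R ^ a * (1 + Real.log R) ^ m) := by
  classical
  -- topological instances on the factors
  haveI : ∀ w : {w : InfinitePlace L // w.IsComplex}, SecondCountableTopology ↥(archLocal L 2 (Matrix.of fun i j : Fin 2 => if i.val + j.val + 1 = 2 then (1 : L) else 0) w) := fun w => secondCountableTopology_archLocal L 2 _ w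
  haveI : ∀ w : {w : InfinitePlace L // w.IsComplex}, LocallyCompactSpace ↥(archLocal L 2 (Matrix.of fun i j : Fin 2 => if i.val + j.val + 1 = 2 then (1 : L) else 0) w) := fun w => locallyCompactSpace_archLocal L 2 _ w
  haveI := locallyCompactSpace_mixedSpaceGL L 2
  haveI := locallyCompactSpace_mixedSpaceGL L 1
  haveI := secondCountableTopology_mixedSpaceGL L 2
  haveI := secondCountableTopology_mixedSpaceGL L 1
  haveI : LocallyCompactSpace ↥(UnitaryGroup.arch (↥(maximalRealSubfield L)) L (IsCMField.complexConj L) 2 (Matrix.of fun i j : Fin 2 => if i.val + j.val + 1 = 2 then (1 : L) else 0)) := (UnitaryGroup.isClosed_arch (↥(maximalRealSubfield L)) L (IsCMField.complexConj L) 2 _).isClosedEmbedding_subtypeVal.locallyCompactSpace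
  haveI : LocallyCompactSpace ↥(UnitaryGroup.arch (↥(maximalRealSubfield L)) L (IsCMField.complexConj L) 1 (Matrix.of fun i j : Fin 1 => if i.val + j.val + 1 = 1 then (1 : L) else 0)) := (UnitaryGroup.isClosed_arch (↥(maximalRealSubfield L)) L (IsCMField.complexConj L) 1 _).isClosedEmbedding_subtypeVal.locallyCompactSpace
  haveI : SecondCountableTopology ↥(UnitaryGroup.arch (↥(maximalRealSubfield L)) L (IsCMField.complexConj L) 2 (Matrix.of fun i j : Fin 2 => if i.val + j.val + 1 = 2 then (1 : L) else 0)) := Topology.IsEmbedding.subtypeVal.secondCountableTopology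
  haveI : SecondCountableTopology ↥(UnitaryGroup.arch (↥(maximalRealSubfield L)) L (IsCMField.complexConj L) 1 (Matrix.of fun i j : Fin 1 => if i.val + j.val + 1 = 1 then (1 : L) else 0)) := Topology.IsEmbedding.subtypeVal.secondCountableTopology
  haveI : CompactSpace ↥(UnitaryGroup.arch (↥(maximalRealSubfield L)) L (IsCMField.complexConj L) 1 (Matrix.of fun i j : Fin 1 => if i.val + j.val + 1 = 1 then (1 : L) else 0)) := by
    refine isCompact_iff_compactSpace.1 (UnitaryGroup.isCompact_arch_cm (N := 1) (L := L) (H := _) fun w => Or.inl ?_)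
    have h1 : (Matrix.of fun i j : Fin 1 => if i.val + j.val + 1 = 1 then (1 : L) else 0).map w.1.embedding = 1 := by
      ext i j; fin_cases i; fin_cases j; simp [Matrix.map_apply]
    rw [h1]
    exact Matrix.PosDef.one
  -- Borel structures on `U(Φ₁)_∞` and on the target product
  letI mU : MeasurableSpace ↥(UnitaryGroup.arch (↥(maximalRealSubfield L)) L (IsCMField.complexConj L) 1 (Matrix.of fun i j : Fin 1 => if i.val + j.val + 1 = 1 then (1 : L) else 0)) := borel _
  haveI : BorelSpace ↥(UnitaryGroup.arch (↥(maximalRealSubfield L)) L (IsCMField.complexConj L) 1 (Matrix.of fun i j : Fin 1 => if i.val + j.val + 1 = 1 then (1 : L) else 0)) := ⟨rfl⟩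
  -- the Haar measures on the model
  set ν : ∀ w : {w : InfinitePlace L // w.IsComplex}, Measure ↥(archLocal L 2 (Matrix.of fun i j : Fin 2 => if i.val + j.val + 1 = 2 then (1 : L) else 0) w) := fun w => Measure.haar with hν
  set ν₁ : Measure ↥(UnitaryGroup.arch (↥(maximalRealSubfield L)) L (IsCMField.complexConj L) 1 (Matrix.of fun i j : Fin 1 => if i.val + j.val + 1 = 1 then (1 : L) else 0)) := Measure.haar with hν₁
  set μT : Measure ((∀ w : {w : InfinitePlace L // w.IsComplex}, ↥(archLocal L 2 (Matrix.of fun i j : Fin 2 => if i.val + j.val + 1 = 2 then (1 : L) else 0) w)) × ↥(UnitaryGroup.arch (↥(maximalRealSubfield L)) L (IsCMField.complexConj L) 1 (Matrix.of fun i j : Fin 1 => if i.val + j.val + 1 = 1 then (1 : L) else 0))) := (Measure.pi ν).prod ν₁ with hμT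
  haveI : (Measure.pi ν).IsHaarMeasure := inferInstance
  haveI : μT.IsHaarMeasure := by rw [hμT]; infer_instance
  -- the iso `Ψ = archPiEquivCM × id`
  set e := archPiEquivCM 2 L (Matrix.of fun i j : Fin 2 => if i.val + j.val + 1 = 2 then (1 : L) else 0) with he
  let Ψ : (↥(UnitaryGroup.arch (↥(maximalRealSubfield L)) L (IsCMField.complexConj L) 2 (Matrix.of fun i j : Fin 2 => if i.val + j.val + 1 = 2 then (1 : L) else 0)) × ↥(UnitaryGroup.arch (↥(maximalRealSubfield L)) L (IsCMField.complexConj L) 1 (Matrix.of fun i j : Fin 1 => if i.val + j.val + 1 = 1 then (1 : L) else 0))) ≃ₜ* ((∀ w : {w : InfinitePlace L // w.IsComplex}, ↥(archLocal L 2 (Matrix.of fun i j : Fin 2 => if i.val + j.val + 1 = 2 then (1 : L) else 0) w)) × ↥(UnitaryGroup.arch (↥(maximalRealSubfield L)) L (IsCMField.complexConj L) 1 (Matrix.of fun i j : Fin 1 => if i.val + j.val + 1 = 1 then (1 : L) else 0))) :=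
    { e.toMulEquiv.prodCongr (MulEquiv.refl _) with
      continuous_toFun := (e.continuous.comp continuous_fst).prodMk continuous_snd
      continuous_invFun := (e.symm.continuous.comp continuous_fst).prodMk continuous_snd }
  have hΨsymm : ∀ p : (∀ w : {w : InfinitePlace L // w.IsComplex}, ↥(archLocal L 2 (Matrix.of fun i j : Fin 2 => if i.val + j.val + 1 = 2 then (1 : L) else 0) w)) × ↥(UnitaryGroup.arch (↥(maximalRealSubfield L)) L (IsCMField.complexConj L) 1 (Matrix.of fun i j : Fin 1 => if i.val + j.val + 1 = 1 then (1 : L) else 0)), Ψ.symm p = (e.symm p.1, p.2) := fun p => rfl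
  set μH : Measure (↥(UnitaryGroup.arch (↥(maximalRealSubfield L)) L (IsCMField.complexConj L) 2 (Matrix.of fun i j : Fin 2 => if i.val + j.val + 1 = 2 then (1 : L) else 0)) × ↥(UnitaryGroup.arch (↥(maximalRealSubfield L)) L (IsCMField.complexConj L) 1 (Matrix.of fun i j : Fin 1 => if i.val + j.val + 1 = 1 then (1 : L) else 0))) := Measure.map Ψ.symm μT with hμH
  haveI : μH.IsHaarMeasure := by rw [hμH]; infer_instance
  -- Haar uniqueness
  have hνH : νH = haarScalarFactor νH μH • μH := isMulLeftInvariant_eq_smul νH μH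
  -- §1 on the model
  obtain ⟨A, m, hA0, hA⟩ := exists_pi_measure_setOf_prod_le_of_marginal_growth ν hF1 ha (fun w => hgrowth w (ν w))
  have hfin : ν₁ Set.univ ≠ ⊤ := measure_ne_top ν₁ _
  refine ⟨(haarScalarFactor νH μH : ℝ) * (ν₁ Set.univ).toReal * A, m, fun R hR => ?_⟩
  -- the set and its model
  set S : Set (↥(UnitaryGroup.arch (↥(maximalRealSubfield L)) L (IsCMField.complexConj L) 2 (Matrix.of fun i j : Fin 2 => if i.val + j.val + 1 = 2 then (1 : L) else 0)) × ↥(UnitaryGroup.arch (↥(maximalRealSubfield L)) L (IsCMField.complexConj L) 1 (Matrix.of fun i j : Fin 1 => if i.val + j.val + 1 = 1 then (1 : L) else 0))) := {k | ∏ w, F w (e k.1 w) ≤ R} with hS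
  have hpre : Ψ.symm ⁻¹' S = {y : ∀ w : {w : InfinitePlace L // w.IsComplex}, ↥(archLocal L 2 (Matrix.of fun i j : Fin 2 => if i.val + j.val + 1 = 2 then (1 : L) else 0) w) | ∏ w, F w (y w) ≤ R} ×ˢ (Set.univ : Set ↥(UnitaryGroup.arch (↥(maximalRealSubfield L)) L (IsCMField.complexConj L) 1 (Matrix.of fun i j : Fin 1 => if i.val + j.val + 1 = 1 then (1 : L) else 0))) := by
    ext p
    simp only [Set.mem_preimage, hΨsymm, hS, Set.mem_setOf_eq, Set.mem_prod, Set.mem_univ, and_true, he,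
      ContinuousMulEquiv.apply_symm_apply]
  have hmap : μH S = μT (Ψ.symm ⁻¹' S) := by
    rw [hμH, show (⇑Ψ.symm : _ → _) = ⇑Ψ.symm.toHomeomorph.toMeasurableEquiv from rfl, MeasurableEquiv.map_apply]
  set t : ℝ := (ν₁ Set.univ).toReal with htdef
  have ht : ν₁ Set.univ = ENNReal.ofReal t := (ENNReal.ofReal_toReal hfin).symm
  have hc : ((haarScalarFactor νH μH : ℝ≥0) : ℝ≥0∞) = ENNReal.ofReal (haarScalarFactor νH μH : ℝ) := ENNReal.ofReal_coe_nnreal.symm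
  calc νH S = (haarScalarFactor νH μH • μH) S := by rw [← hνH]
    _ = haarScalarFactor νH μH * μH S := by rw [Measure.coe_nnreal_smul_apply]
    _ = haarScalarFactor νH μH * ((Measure.pi ν) {y | ∏ w, F w (y w) ≤ R} * ν₁ Set.univ) := by rw [hmap, hpre, hμT, Measure.prod_prod]
    _ ≤ haarScalarFactor νH μH * (ENNReal.ofReal (A * R ^ a * (1 + Real.log R) ^ m) * ν₁ Set.univ) := by
        gcongr
        exact hA R hR
    _ = ENNReal.ofReal ((haarScalarFactor νH μH : ℝ) * t * A * R ^ a * (1 + Real.log R) ^ m) := by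
        have hX0 : 0 ≤ A * R ^ a * (1 + Real.log R) ^ m :=
          mul_nonneg (mul_nonneg hA0 (Real.rpow_nonneg (zero_le_one.trans hR) a)) (pow_nonneg (by linarith [Real.log_nonneg hR]) m)
        rw [hc, ht, ← ENNReal.ofReal_mul hX0, ← ENNReal.ofReal_mul (NNReal.coe_nonneg _)]
        congr 1
        ring

end HInfty

/-! ## §3 The Hilbert–Schmidt reading from the per-place LINEAR growth of HS-balls in `U(1,1)` ((T2-out), hypothesis) -/

section HS

variable (L : Type) [Field L] [NumberField L] [IsCMField L]

/-- **`‖y‖²_HS ≥ 2` on `U(Φ₂)(ℂ) ≅ U(1,1)`** in the plain-matrix currency of ★ `ArchEllipticOrbitHSBall` (`ȳᵀ Φ₂ y = Φ₂` gives `|det y| = 1`; AM–GM).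
[folklore] [cite: BeuzartPlessis2020Asterisque, §1.5 Prop. 1.5.1 (i) p. 29] -/
theorem two_le_hs_of_archPlane_unitary {y : Matrix (Fin 2) (Fin 2) ℂ}
    (hy : (y.map (starRingEnd ℂ))ᵀ * (Matrix.of fun i j : Fin 2 => if i.val + j.val + 1 = 2 then (1 : ℂ) else 0) * y =
      Matrix.of fun i j : Fin 2 => if i.val + j.val + 1 = 2 then (1 : ℂ) else 0) :
    2 ≤ ∑ i : Fin 2, ∑ j : Fin 2, ‖y i j‖ ^ 2 := by
  have hJ : (Matrix.of fun i j : Fin 2 => if i.val + j.val + 1 = 2 then (1 : ℂ) else 0).det = -1 := by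
    rw [Matrix.det_fin_two]; simp [Matrix.of_apply]
  have hct : (y.map (starRingEnd ℂ))ᵀ = yᴴ := rfl
  have hdet := congrArg Matrix.det hy
  rw [Matrix.det_mul, Matrix.det_mul, hct, Matrix.det_conjTranspose, hJ] at hdet
  have hdet1 : ‖y.det‖ = 1 := by
    have h := congrArg (fun t : ℂ => ‖t‖) hdet
    simp only [norm_mul, norm_star, norm_neg, norm_one, mul_one] at h
    rcases mul_self_eq_one_iff.1 h with h' | h'
    · exact h'
    · linarith [norm_nonneg y.det]
  rw [Matrix.det_fin_two] at hdet1
  simp only [Fin.sum_univ_two]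
  have htri : (1 : ℝ) ≤ ‖y 0 0‖ * ‖y 1 1‖ + ‖y 0 1‖ * ‖y 1 0‖ := by
    calc (1 : ℝ) = ‖y 0 0 * y 1 1 - y 0 1 * y 1 0‖ := hdet1.symm
      _ ≤ ‖y 0 0 * y 1 1‖ + ‖y 0 1 * y 1 0‖ := norm_sub_le _ _
      _ = ‖y 0 0‖ * ‖y 1 1‖ + ‖y 0 1‖ * ‖y 1 0‖ := by rw [norm_mul, norm_mul]
  nlinarith [two_mul_le_add_sq ‖y 0 0‖ ‖y 1 1‖, two_mul_le_add_sq ‖y 0 1‖ ‖y 1 0‖]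

omit [NumberField L] [IsCMField L] in
/-- **JUNCTION WITH (T2-out).**  The place carrier ★ `archLocal L 2 Φ₂ w` IS the subgroup `unitaryGroupOfForm (starRingEnd ℂ) Φ₂` of `GL₂(ℂ)` (★ `antidiagOne_map`), so LH3-p02's
per-place output «for every Haar `ν` on `U(Φ₂)(ℂ)`, `ν{‖g‖²_HS ≤ ρ} ≤ C ρ` for `ρ ≥ 2`» (taken here as the HYPOTHESIS `hT2`, its A-boxed text verbatim) yields the marginal
growth of §2 for `F_w = ‖·‖²_HS + 1` and every `ρ ≥ 1` (below `3` the sub-level set is empty, `‖·‖²_HS ≥ 2`). [cite: BeuzartPlessis2020Asterisque, §1.8 p. 39; §1.2 (1.2.4) p. 21] -/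
theorem haar_hsWeight_succ_le_of_unitaryGroupOfForm (w : {w : InfinitePlace L // w.IsComplex})
    (hT2 : ∀ [MeasurableSpace ↥(unitaryGroupOfForm (starRingEnd ℂ) (Matrix.of fun i j : Fin 2 => if i.val + j.val + 1 = 2 then (1 : ℂ) else 0))]
      [BorelSpace ↥(unitaryGroupOfForm (starRingEnd ℂ) (Matrix.of fun i j : Fin 2 => if i.val + j.val + 1 = 2 then (1 : ℂ) else 0))]
      (ν : Measure ↥(unitaryGroupOfForm (starRingEnd ℂ) (Matrix.of fun i j : Fin 2 => if i.val + j.val + 1 = 2 then (1 : ℂ) else 0))) [ν.IsHaarMeasure],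
      ∃ C : ℝ, ∀ ρ : ℝ, 2 ≤ ρ → ν {g | ∑ i : Fin 2, ∑ j : Fin 2, ‖((g : GL (Fin 2) ℂ) : Matrix (Fin 2) (Fin 2) ℂ) i j‖ ^ 2 ≤ ρ} ≤ ENNReal.ofReal (C * ρ))
    [MeasurableSpace ↥(archLocal L 2 (Matrix.of fun i j : Fin 2 => if i.val + j.val + 1 = 2 then (1 : L) else 0) w)] [BorelSpace ↥(archLocal L 2 (Matrix.of fun i j : Fin 2 => if i.val + j.val + 1 = 2 then (1 : L) else 0) w)] (ν : Measure ↥(archLocal L 2 (Matrix.of fun i j : Fin 2 => if i.val + j.val + 1 = 2 then (1 : L) else 0) w)) [ν.IsHaarMeasure] :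
    ∃ C : ℝ, ∀ ρ : ℝ, 1 ≤ ρ →
      ν {y | ∑ i : Fin 2, ∑ j : Fin 2, ‖((y : GL (Fin 2) ℂ) : Matrix (Fin 2) (Fin 2) ℂ) i j‖ ^ 2 + 1 ≤ ρ} ≤ ENNReal.ofReal (C * ρ ^ (1 : ℝ)) := by
  classical
  -- the two subgroups coincide
  have heq : archLocal L 2 (Matrix.of fun i j : Fin 2 => if i.val + j.val + 1 = 2 then (1 : L) else 0) w = unitaryGroupOfForm (starRingEnd ℂ) (Matrix.of fun i j : Fin 2 => if i.val + j.val + 1 = 2 then (1 : ℂ) else 0) := by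
    unfold archLocal; rw [antidiagOne_map]
  -- transport along the (continuous) identity isomorphism of the equal subgroups
  let θ : ↥(archLocal L 2 (Matrix.of fun i j : Fin 2 => if i.val + j.val + 1 = 2 then (1 : L) else 0) w) ≃ₜ* ↥(unitaryGroupOfForm (starRingEnd ℂ) (Matrix.of fun i j : Fin 2 => if i.val + j.val + 1 = 2 then (1 : ℂ) else 0)) :=
    { MulEquiv.subgroupCongr heq with
      continuous_toFun := continuous_subtype_val.subtype_mk _
      continuous_invFun := continuous_subtype_val.subtype_mk _ }
  have hθval : ∀ y : ↥(archLocal L 2 (Matrix.of fun i j : Fin 2 => if i.val + j.val + 1 = 2 then (1 : L) else 0) w), ((θ y : ↥(unitaryGroupOfForm (starRingEnd ℂ) _)) : GL (Fin 2) ℂ) = (y : GL (Fin 2) ℂ) := fun y => rfl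
  letI mU : MeasurableSpace ↥(unitaryGroupOfForm (starRingEnd ℂ) (Matrix.of fun i j : Fin 2 => if i.val + j.val + 1 = 2 then (1 : ℂ) else 0)) := borel _
  haveI : BorelSpace ↥(unitaryGroupOfForm (starRingEnd ℂ) (Matrix.of fun i j : Fin 2 => if i.val + j.val + 1 = 2 then (1 : ℂ) else 0)) := ⟨rfl⟩
  haveI : (Measure.map θ ν).IsHaarMeasure := inferInstance
  obtain ⟨C, hC⟩ := hT2 (Measure.map θ ν)
  refine ⟨max C 0, fun ρ hρ => ?_⟩
  by_cases h3 : ρ < 3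
  · -- empty sub-level set
    have hempty : {y : ↥(archLocal L 2 (Matrix.of fun i j : Fin 2 => if i.val + j.val + 1 = 2 then (1 : L) else 0) w) | ∑ i : Fin 2, ∑ j : Fin 2, ‖((y : GL (Fin 2) ℂ) : Matrix (Fin 2) (Fin 2) ℂ) i j‖ ^ 2 + 1 ≤ ρ} = ∅ := by
      ext y
      simp only [Set.mem_setOf_eq, Set.mem_empty_iff_false, iff_false, not_le]
      have hy : (y : GL (Fin 2) ℂ) ∈ unitaryGroupOfForm (starRingEnd ℂ) (Matrix.of fun i j : Fin 2 => if i.val + j.val + 1 = 2 then (1 : ℂ) else 0) := heq ▸ y.2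
      have h2 := two_le_hs_of_archPlane_unitary hy
      linarith
    rw [hempty, measure_empty]
    exact bot_le
  · rw [not_lt] at h3
    have hρ2 : 2 ≤ ρ - 1 := by linarith
    have hsub : {y : ↥(archLocal L 2 (Matrix.of fun i j : Fin 2 => if i.val + j.val + 1 = 2 then (1 : L) else 0) w) | ∑ i : Fin 2, ∑ j : Fin 2, ‖((y : GL (Fin 2) ℂ) : Matrix (Fin 2) (Fin 2) ℂ) i j‖ ^ 2 + 1 ≤ ρ} ⊆
        θ ⁻¹' {g | ∑ i : Fin 2, ∑ j : Fin 2, ‖((g : GL (Fin 2) ℂ) : Matrix (Fin 2) (Fin 2) ℂ) i j‖ ^ 2 ≤ ρ - 1} := by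
      intro y hy
      rw [Set.mem_preimage, Set.mem_setOf_eq, hθval]
      have hy' : ∑ i : Fin 2, ∑ j : Fin 2, ‖((y : GL (Fin 2) ℂ) : Matrix (Fin 2) (Fin 2) ℂ) i j‖ ^ 2 + 1 ≤ ρ := hy
      linarith
    calc ν {y : ↥(archLocal L 2 (Matrix.of fun i j : Fin 2 => if i.val + j.val + 1 = 2 then (1 : L) else 0) w) | ∑ i : Fin 2, ∑ j : Fin 2, ‖((y : GL (Fin 2) ℂ) : Matrix (Fin 2) (Fin 2) ℂ) i j‖ ^ 2 + 1 ≤ ρ}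
        ≤ ν (θ ⁻¹' {g | ∑ i : Fin 2, ∑ j : Fin 2, ‖((g : GL (Fin 2) ℂ) : Matrix (Fin 2) (Fin 2) ℂ) i j‖ ^ 2 ≤ ρ - 1}) := measure_mono hsub
      _ = Measure.map θ ν {g | ∑ i : Fin 2, ∑ j : Fin 2, ‖((g : GL (Fin 2) ℂ) : Matrix (Fin 2) (Fin 2) ℂ) i j‖ ^ 2 ≤ ρ - 1} := by
          rw [show (⇑θ : _ → _) = ⇑θ.toHomeomorph.toMeasurableEquiv from rfl, MeasurableEquiv.map_apply]
      _ ≤ ENNReal.ofReal (C * (ρ - 1)) := hC (ρ - 1) hρ2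
      _ ≤ ENNReal.ofReal (max C 0 * ρ ^ (1 : ℝ)) := by
          rw [Real.rpow_one]
          refine ENNReal.ofReal_le_ofReal ?_
          nlinarith [le_max_left C 0, le_max_right C 0]

/-- **THE GROUP-SIDE HS READING.**  For every Haar measure `ν_H` on `H_∞`, from (T2-out) at every complex place: `ν_H{k ∣ archHSGL(ι_∞ k) ≤ R} ≤ A R (1 + log R)^m` for `R ≥ 1`
(★ `archHSGL_endoEmbArch`: `archHSGL (ι_∞ k) = ∏_w (‖k_{2,w}‖²_HS + 1)`, the place components read through ★ `archPiEquivCM` ∕ `coe_archPiEquivCM_apply`; §2 with `a = 1`).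
[cite: BeuzartPlessis2020Asterisque, §1.8 p. 39; §1.2 (1.2.4) p. 21] [cite: Rogawski1990, §14.3 p. 234] -/
theorem haar_setOf_archHSGL_endoEmbArch_le
    (hT2 : ∀ [MeasurableSpace ↥(unitaryGroupOfForm (starRingEnd ℂ) (Matrix.of fun i j : Fin 2 => if i.val + j.val + 1 = 2 then (1 : ℂ) else 0))]
      [BorelSpace ↥(unitaryGroupOfForm (starRingEnd ℂ) (Matrix.of fun i j : Fin 2 => if i.val + j.val + 1 = 2 then (1 : ℂ) else 0))]
      (ν : Measure ↥(unitaryGroupOfForm (starRingEnd ℂ) (Matrix.of fun i j : Fin 2 => if i.val + j.val + 1 = 2 then (1 : ℂ) else 0))) [ν.IsHaarMeasure],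
      ∃ C : ℝ, ∀ ρ : ℝ, 2 ≤ ρ → ν {g | ∑ i : Fin 2, ∑ j : Fin 2, ‖((g : GL (Fin 2) ℂ) : Matrix (Fin 2) (Fin 2) ℂ) i j‖ ^ 2 ≤ ρ} ≤ ENNReal.ofReal (C * ρ))
    [MeasurableSpace (↥(UnitaryGroup.arch (↥(maximalRealSubfield L)) L (IsCMField.complexConj L) 2 (Matrix.of fun i j : Fin 2 => if i.val + j.val + 1 = 2 then (1 : L) else 0)) × ↥(UnitaryGroup.arch (↥(maximalRealSubfield L)) L (IsCMField.complexConj L) 1 (Matrix.of fun i j : Fin 1 => if i.val + j.val + 1 = 1 then (1 : L) else 0)))] [BorelSpace (↥(UnitaryGroup.arch (↥(maximalRealSubfield L)) L (IsCMField.complexConj L) 2 (Matrix.of fun i j : Fin 2 => if i.val + j.val + 1 = 2 then (1 : L) else 0)) × ↥(UnitaryGroup.arch (↥(maximalRealSubfield L)) L (IsCMField.complexConj L) 1 (Matrix.of fun i j : Fin 1 => if i.val + j.val + 1 = 1 then (1 : L) else 0)))]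
    (νH : Measure (↥(UnitaryGroup.arch (↥(maximalRealSubfield L)) L (IsCMField.complexConj L) 2 (Matrix.of fun i j : Fin 2 => if i.val + j.val + 1 = 2 then (1 : L) else 0)) × ↥(UnitaryGroup.arch (↥(maximalRealSubfield L)) L (IsCMField.complexConj L) 1 (Matrix.of fun i j : Fin 1 => if i.val + j.val + 1 = 1 then (1 : L) else 0)))) [νH.IsHaarMeasure] :
    ∃ (A : ℝ) (m : ℕ), ∀ R : ℝ, 1 ≤ R →
      νH {k | archHSGL L 3 ((endoEmbArch L k).val : GL (Fin 3) (mixedSpace L)) ≤ R} ≤ ENNReal.ofReal (A * R ^ (1 : ℝ) * (1 + Real.log R) ^ m) := by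
  classical
  letI mU : ∀ w : {w : InfinitePlace L // w.IsComplex}, MeasurableSpace ↥(archLocal L 2 (Matrix.of fun i j : Fin 2 => if i.val + j.val + 1 = 2 then (1 : L) else 0) w) := fun _ => borel _
  haveI : ∀ w : {w : InfinitePlace L // w.IsComplex}, BorelSpace ↥(archLocal L 2 (Matrix.of fun i j : Fin 2 => if i.val + j.val + 1 = 2 then (1 : L) else 0) w) := fun _ => ⟨rfl⟩
  obtain ⟨A, m, hA⟩ := haar_setOf_prod_place_le_of_marginal_growth L νH
    (fun w (y : ↥(archLocal L 2 (Matrix.of fun i j : Fin 2 => if i.val + j.val + 1 = 2 then (1 : L) else 0) w)) => ∑ i : Fin 2, ∑ j : Fin 2, ‖((y : GL (Fin 2) ℂ) : Matrix (Fin 2) (Fin 2) ℂ) i j‖ ^ 2 + 1)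
    (fun w y => by
      have : (0 : ℝ) ≤ ∑ i : Fin 2, ∑ j : Fin 2, ‖((y : GL (Fin 2) ℂ) : Matrix (Fin 2) (Fin 2) ℂ) i j‖ ^ 2 :=
        Finset.sum_nonneg fun _ _ => Finset.sum_nonneg fun _ _ => by positivity
      linarith)
    zero_le_one (fun w ν _ => haar_hsWeight_succ_le_of_unitaryGroupOfForm L w hT2 ν)
  refine ⟨A, m, fun R hR => ?_⟩
  have hset : {k : ↥(UnitaryGroup.arch (↥(maximalRealSubfield L)) L (IsCMField.complexConj L) 2 (Matrix.of fun i j : Fin 2 => if i.val + j.val + 1 = 2 then (1 : L) else 0)) × ↥(UnitaryGroup.arch (↥(maximalRealSubfield L)) L (IsCMField.complexConj L) 1 (Matrix.of fun i j : Fin 1 => if i.val + j.val + 1 = 1 then (1 : L) else 0)) | archHSGL L 3 ((endoEmbArch L k).val : GL (Fin 3) (mixedSpace L)) ≤ R} =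
      {k | ∏ w, (∑ i : Fin 2, ∑ j : Fin 2, ‖(((archPiEquivCM 2 L (Matrix.of fun i j : Fin 2 => if i.val + j.val + 1 = 2 then (1 : L) else 0) k.1 w : ↥(archLocal L 2 (Matrix.of fun i j : Fin 2 => if i.val + j.val + 1 = 2 then (1 : L) else 0) w)) : GL (Fin 2) ℂ) : Matrix (Fin 2) (Fin 2) ℂ) i j‖ ^ 2 + 1) ≤ R} := by
    ext k
    rw [Set.mem_setOf_eq, Set.mem_setOf_eq, archHSGL_endoEmbArch]
    rfl
  rw [hset]
  exact hA R hR

end HS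

end Literature.NumberTheory.Rogawski1990

end
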